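import Summits.AtomisticToContinuum.BoseEinsteinCondensation.Theorems.GaussianDominationCan.Negative.ProductCalculus

/-!
# Crux `GaussianDominationCan` — negative-side toolkit II: product trial states and `φ^{⊗N}`

Support file (crux disprover, `stmt-AtomisticToContinuum-9479`).  `N`-body product states on the
torus (smoothness, periodicity, Bose symmetry of `φ^{⊗N}`, norm, partial derivatives, `Θ` and the
source integral as a sum over `S ∋ 0` of products of one-body cell integrals), and the symmetric
two-mode product state `symState = ((a + b e_n))^{⊗N}` with its source lower bound
(`norm_sourceIntegral_symFun_ge`) and its exact free kinetic energy (`periodicEnergy_symState`).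
All [folklore].
-/

noncomputable section

namespace Summit.AtomisticToContinuum.BoseEinsteinCondensation.Theorems.GaussianDominationCan.Negative

open MeasureTheory Literature.MathematicalPhysics.QuantumManyBody.BoseGas
open scoped ENNReal NNReal ComplexConjugate

variable {N : ℕ} {L : ℝ}

/-! ### `N`-body product states -/

section NBody

/-- A product of `C¹` one-body factors is `C¹`. [folklore] -/
theorem contDiff_prodFun {g : Fin N → Space → ℂ} (hg : ∀ i, ContDiff ℝ 1 (g i)) :
    ContDiff ℝ 1 (prodFun g) :=
  contDiff_prod fun i _ => (hg i).comp (contDiff_apply ℝ Space i)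

/-- A product of continuous one-body factors is continuous. [folklore] -/
theorem continuous_prodFun {g : Fin N → Space → ℂ} (hg : ∀ i, Continuous (g i)) :
    Continuous (prodFun g) :=
  continuous_finsetProd _ fun i _ => (hg i).comp (continuous_apply i)

/-- A product of periodic one-body factors is periodic in every particle. [folklore] -/
theorem prodFun_periodic {g : Fin N → Space → ℂ}
    (hg : ∀ i (x : Space) (k : Fin 3), g i (x + EuclideanSpace.single k L) = g i x)
    (X : Config N) (i : Fin N) (k : Fin 3) :
    prodFun g (X + Pi.single i (EuclideanSpace.single k L)) = prodFun g X := by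
  unfold prodFun
  refine Finset.prod_congr rfl fun j _ => ?_
  rw [Pi.add_apply]
  by_cases hj : j = i
  · subst hj
    rw [Pi.single_eq_same, hg]
  · rw [Pi.single_eq_of_ne hj, add_zero]

/-- `φ^{⊗N}` is Bose-symmetric. [folklore] -/
theorem prodFun_const_symm (φ : Space → ℂ) (σ : Equiv.Perm (Fin N)) (X : Config N) :
    prodFun (fun _ : Fin N => φ) (X ∘ σ) = prodFun (fun _ => φ) X := by
  unfold prodFun
  exact Equiv.prod_comp σ (fun i => φ (X i))

/-- `‖Π_i g_i(x_i)‖₊² = Π_i ‖g_i(x_i)‖₊²`. [folklore] -/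
theorem nnnorm_sq_prodFun (g : Fin N → Space → ℂ) (X : Config N) :
    ((‖prodFun g X‖₊ : ℝ≥0∞) ^ 2) = ∏ i, ((‖g i (X i)‖₊ : ℝ≥0∞) ^ 2) := by
  unfold prodFun
  rw [nnnorm_prod, ENNReal.ofNNReal_finsetProd, ← Finset.prod_pow]

/-- **Norm of a product state**: `∫⁻_{cell^N} ‖Π g_i‖₊² = Π_i ∫⁻_cell ‖g_i‖₊²`. [folklore] -/
theorem lintegral_nnnorm_sq_prodFun {g : Fin N → Space → ℂ} (hg : ∀ i, Continuous (g i)) :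
    ∫⁻ X in cellN N L, (‖prodFun g X‖₊ : ℝ≥0∞) ^ 2 = ∏ i, ∫⁻ x in cell L, (‖g i x‖₊ : ℝ≥0∞) ^ 2 := by
  simp_rw [nnnorm_sq_prodFun]
  exact lintegral_cellN_prod _ fun i => (hg i).measurable.nnnorm.coe_nnreal_ennreal.pow_const _

/-- **Partial derivatives of a product state**: `∂_{x_i} Π_j g_j = (Π_{j≠i} g_j) ∂g_i`. [folklore] -/
theorem fderiv_prodFun {g : Fin N → Space → ℂ} (hg : ∀ i, Differentiable ℝ (g i)) (X : Config N)
    (i : Fin N) (w : Space) :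
    fderiv ℝ (prodFun g) X (Pi.single i w) =
      (∏ j ∈ Finset.univ.erase i, g j (X j)) * fderiv ℝ (g i) (X i) w := by
  classical
  have hd : ∀ j ∈ (Finset.univ : Finset (Fin N)),
      DifferentiableAt ℝ (fun X : Config N => g j (X j)) X :=
    fun j _ => ((hg j) (X j)).comp X (differentiableAt_apply (𝕜 := ℝ) j X)
  have h := fderiv_finsetProd (𝕜 := ℝ) hd
  have hpf : prodFun g = (∏ j ∈ Finset.univ, (fun (j : Fin N) (X : Config N) => g j (X j)) j ·) := by
    funext X
    simp [prodFun]
  rw [hpf, h, FunLike.coe_sum, Finset.sum_apply]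
  have hc : ∀ j, fderiv ℝ (fun X : Config N => g j (X j)) X (Pi.single i w) =
      fderiv ℝ (g j) (X j) ((Pi.single i w : Config N) j) := by
    intro j
    have hcomp := ((hg j (X j)).hasFDerivAt.comp X (hasFDerivAt_apply (𝕜 := ℝ) j X)).fderiv
    rw [show (fun X : Config N => g j (X j)) = g j ∘ (fun f : Config N => f j) from rfl, hcomp]
    rfl
  simp only [FunLike.coe_smul, Pi.smul_apply, hc]
  rw [Finset.sum_eq_single i (fun j _ hji => by rw [Pi.single_eq_of_ne hji, map_zero, smul_zero])
    (fun h => (h (Finset.mem_univ i)).elim), Pi.single_eq_same, smul_eq_mul]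

/-- **`Θ` of a product state**: `Θ = Σ_{S∋0} |S|^{-1/2} Π_i (i ∈ S ? ḡ_i : g_i - ḡ_i)`. [folklore] -/
theorem theta_prodFun (m : ℕ) (L : ℝ) (g : Fin (m + 1) → Space → ℂ) (X : Config (m + 1)) :
    theta m L (prodFun g) X =
      ∑ S ∈ (Finset.univ : Finset (Finset (Fin (m + 1)))).filter (fun S => (0 : Fin (m + 1)) ∈ S),
        ((Real.sqrt (S.card : ℝ))⁻¹ : ℂ) * prodFun (fun i => factorT L S i (g i)) X := by
  unfold theta
  simp_rw [modeProj_prodFun]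

/-- The crux's phase `e^{ik·x₀}` is the plane wave `e_n(x₀)`. [folklore] -/
theorem phase_eq_cellWave (m : ℕ) (L : ℝ) (n : Fin 3 → ℤ) (X : Config (m + 1)) :
    phase m L n X = cellWave L n (X 0) := by
  rw [phase, cellWave_apply]
  congr 1
  push_cast
  ring

/-- The factors of the source integrand for a product state. -/
def sourceFactor (L : ℝ) (n : Fin 3 → ℤ) (S : Finset (Fin N)) (g : Fin N → Space → ℂ)
    [NeZero N] (i : Fin N) (x : Space) : ℂ :=
  conj (g i x) * (if i = 0 then cellWave L n x else 1) * factorT L S i (g i) x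

/-- The source integrand of a product state is a product of one-body factors. [folklore] -/
theorem sourceIntegrand_prodFun (m : ℕ) (L : ℝ) (n : Fin 3 → ℤ) (S : Finset (Fin (m + 1)))
    (g : Fin (m + 1) → Space → ℂ) (X : Config (m + 1)) :
    conj (prodFun g X) * cellWave L n (X 0) * prodFun (fun i => factorT L S i (g i)) X =
      ∏ i, sourceFactor L n S g i (X i) := by
  unfold sourceFactor prodFun
  rw [Finset.prod_mul_distrib, Finset.prod_mul_distrib, map_prod, Finset.prod_ite_eq']
  simp

/-- The factor-wise action of `Q_S` preserves continuity. [folklore] -/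
theorem continuous_factorT (L : ℝ) (S : Finset (Fin N)) (i : Fin N) {h : Space → ℂ}
    (hh : Continuous h) : Continuous (factorT L S i h) := by
  unfold factorT
  split_ifs
  · exact continuous_const
  · exact hh.sub continuous_const

/-- **Source integral of a product state** as a sum over `S ∋ 0` of products of one-body cell integrals. [folklore] -/
theorem sourceIntegral_prodFun (m : ℕ) (L : ℝ) (n : Fin 3 → ℤ) (g : Fin (m + 1) → Space → ℂ)
    (hg : ∀ i, Continuous (g i)) :
    sourceIntegral m L n (prodFun g) =
      ∑ S ∈ (Finset.univ : Finset (Finset (Fin (m + 1)))).filter (fun S => (0 : Fin (m + 1)) ∈ S),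
        ((Real.sqrt (S.card : ℝ))⁻¹ : ℂ) * ∏ i, ∫ x in cell L, sourceFactor L n S g i x := by
  unfold sourceIntegral
  simp_rw [phase_eq_cellWave, theta_prodFun, Finset.mul_sum]
  have hint : ∀ S ∈ (Finset.univ : Finset (Finset (Fin (m + 1)))).filter
      (fun S => (0 : Fin (m + 1)) ∈ S),
      Integrable (fun X => conj (prodFun g X) * cellWave L n (X 0) *
        (((Real.sqrt (S.card : ℝ))⁻¹ : ℂ) * prodFun (fun i => factorT L S i (g i)) X))
        ((volume : Measure (Config (m + 1))).restrict (cellN (m + 1) L)) := by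
    intro S _
    refine integrableOn_cellN ?_ L
    refine ((continuous_prodFun hg).star.mul
      ((contDiff_cellWave L n).continuous.comp (continuous_apply 0))).mul
      (continuous_const.mul (continuous_prodFun fun i => continuous_factorT L S i (hg i)))
  rw [integral_finsetSum _ hint]
  refine Finset.sum_congr rfl fun S _ => ?_
  have h : ∀ X, conj (prodFun g X) * cellWave L n (X 0) *
      (((Real.sqrt (S.card : ℝ))⁻¹ : ℂ) * prodFun (fun i => factorT L S i (g i)) X) =
      ((Real.sqrt (S.card : ℝ))⁻¹ : ℂ) * ∏ i, sourceFactor L n S g i (X i) := by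
    intro X
    rw [← sourceIntegrand_prodFun]
    ring
  simp_rw [h]
  rw [integral_const_mul, integral_cellN_prod]

end NBody


/-! ### The symmetric two-mode product state `Φ = φ^{⊗N}`, `φ = a + b e_n` -/

section SymState

variable {m : ℕ} {n : Fin 3 → ℤ} {a b : ℝ}

/-- `φ^{⊗N}`. -/
def symFun (m : ℕ) (L : ℝ) (n : Fin 3 → ℤ) (a b : ℝ) : Config (m + 1) → ℂ :=
  prodFun (fun _ : Fin (m + 1) => oneBody L n a b)

/-- `φ^{⊗N}` as an admissible periodic Bose trial state (normalisation `(a² + b²) L³ = 1`). -/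
def symState (m : ℕ) (hL : 0 < L) (hn : n ≠ 0) (a b : ℝ) (hab : (a ^ 2 + b ^ 2) * L ^ 3 = 1) :
    PeriodicTrialState (m + 1) L where
  ψ := symFun m L n a b
  contDiff := contDiff_prodFun fun _ => contDiff_oneBody L n a b
  periodic X i k := prodFun_periodic (fun _ x k => oneBody_periodic hL.ne' a b x k) X i k
  symm σ X := prodFun_const_symm _ σ X
  norm_eq := by
    show ∫⁻ X in cellN (m + 1) L,
      (‖prodFun (fun _ : Fin (m + 1) => oneBody L n a b) X‖₊ : ℝ≥0∞) ^ 2 = 1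
    rw [lintegral_nnnorm_sq_prodFun (fun _ => continuous_oneBody L n a b)]
    simp only [lintegral_nnnorm_sq_oneBody hL hn, hab, ENNReal.ofReal_one, Finset.prod_const_one]

/-- The (real) values of the one-body source factors of `φ^{⊗N}`. -/
def symVal (L : ℝ) (a b : ℝ) (S : Finset (Fin (m + 1))) (i : Fin (m + 1)) : ℝ :=
  if i = 0 then L ^ 3 * a * b else if i ∈ S then L ^ 3 * a ^ 2 else L ^ 3 * b ^ 2

/-- The one-body source integrals of `φ^{⊗N}`: `αβ`, `α²`, `β²` (times `L³` in the `a, b` variables). [folklore] -/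
theorem integral_sourceFactor_sym (hL : 0 < L) (hn : n ≠ 0) {S : Finset (Fin (m + 1))}
    (hS : (0 : Fin (m + 1)) ∈ S) (i : Fin (m + 1)) :
    ∫ x in cell L, sourceFactor L n S (fun _ => oneBody L n a b) i x = (symVal L a b S i : ℂ) := by
  unfold sourceFactor factorT symVal
  by_cases hi0 : i = 0
  · subst hi0
    simp only [if_pos hS, avg_oneBody hL hn, if_true]
    rw [integral_conj_oneBody_wave_mul hL hn a b a]
    push_cast
    ring
  · simp only [if_neg hi0, mul_one]
    by_cases hiS : i ∈ S
    · simp only [if_pos hiS, avg_oneBody hL hn]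
      rw [integral_conj_oneBody_mul hL hn a b a]
      push_cast
      ring
    · simp only [if_neg hiS, avg_oneBody hL hn]
      have h : ∀ x, oneBody L n a b x - (a : ℂ) = (b : ℂ) * cellWave L n x := fun x => by
        unfold oneBody; ring
      simp_rw [h]
      rw [integral_conj_oneBody_mul_wave hL hn a b b]
      push_cast
      ring

/-- The `S`-term of the source integral of `φ^{⊗N}` (a non-negative real for `a, b ≥ 0`). -/
def symTerm (L : ℝ) (a b : ℝ) (S : Finset (Fin (m + 1))) : ℝ :=
  (Real.sqrt (S.card : ℝ))⁻¹ * ∏ i, symVal L a b S i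

/-- The source integral of `φ^{⊗N}` is a sum of non-negative reals `symTerm`. [folklore] -/
theorem sourceIntegral_symFun (hL : 0 < L) (hn : n ≠ 0) :
    sourceIntegral m L n (symFun m L n a b) =
      ((∑ S ∈ (Finset.univ : Finset (Finset (Fin (m + 1)))).filter
        (fun S => (0 : Fin (m + 1)) ∈ S), symTerm L a b S : ℝ) : ℂ) := by
  unfold symFun
  rw [sourceIntegral_prodFun m L n _ (fun _ => continuous_oneBody L n a b)]
  push_cast
  refine Finset.sum_congr rfl fun S hS => ?_
  rw [Finset.mem_filter] at hS
  unfold symTerm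
  push_cast
  congr 1
  exact Finset.prod_congr rfl fun i _ => integral_sourceFactor_sym hL hn hS.2 i

/-- The one-body source values are `≥ 0` for `a, b ≥ 0`. [folklore] -/
theorem symVal_nonneg (hL : 0 ≤ L) (ha : 0 ≤ a) (hb : 0 ≤ b) (S : Finset (Fin (m + 1)))
    (i : Fin (m + 1)) : 0 ≤ symVal L a b S i := by
  unfold symVal
  split_ifs <;> positivity

/-- `symTerm ≥ 0` for `a, b ≥ 0`. [folklore] -/
theorem symTerm_nonneg (hL : 0 ≤ L) (ha : 0 ≤ a) (hb : 0 ≤ b) (S : Finset (Fin (m + 1))) :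
    0 ≤ symTerm L a b S :=
  mul_nonneg (inv_nonneg.mpr (Real.sqrt_nonneg _))
    (Finset.prod_nonneg fun i _ => symVal_nonneg hL ha hb S i)

/-- The all-condensed (`S = univ`) term: `N^{-1/2} (L³ab) (L³a²)^{N-1}`. [folklore] -/
theorem symTerm_univ (L a b : ℝ) :
    symTerm L a b (Finset.univ : Finset (Fin (m + 1))) =
      (Real.sqrt (m + 1 : ℝ))⁻¹ * (L ^ 3 * a * b) * (L ^ 3 * a ^ 2) ^ m := by
  unfold symTerm symVal
  rw [Finset.card_univ, Fintype.card_fin, Fin.prod_univ_succ]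
  simp only [Finset.mem_univ, if_true, Fin.succ_ne_zero, if_false, Finset.prod_const,
    Finset.card_univ, Fintype.card_fin]
  push_cast
  ring

/-- **Lower bound on the source of `φ^{⊗N}`** by its all-condensed term. -/
theorem norm_sourceIntegral_symFun_ge (hL : 0 < L) (hn : n ≠ 0) (ha : 0 ≤ a) (hb : 0 ≤ b) :
    (Real.sqrt (m + 1 : ℝ))⁻¹ * (L ^ 3 * a * b) * (L ^ 3 * a ^ 2) ^ m ≤
      ‖sourceIntegral m L n (symFun m L n a b)‖ := by
  rw [sourceIntegral_symFun hL hn, Complex.norm_real,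
    Real.norm_of_nonneg (Finset.sum_nonneg fun S _ => symTerm_nonneg hL.le ha hb S), ← symTerm_univ]
  exact Finset.single_le_sum (fun S _ => symTerm_nonneg hL.le ha hb S)
    (Finset.mem_filter.mpr ⟨Finset.mem_univ _, Finset.mem_univ _⟩)

/-! #### Energy of `φ^{⊗N}` for the free gas -/

/-- The free gas has no interaction: `periodicInteraction 0 = 0`. [folklore] -/
theorem periodicInteraction_zero (L : ℝ) (X : Config N) : periodicInteraction 0 L X = 0 := by
  simp [periodicInteraction, periodizedPotential]

/-- **Kinetic density of a product state**: `Σ_i (Π_{j≠i} |g_j|²) |∇g_i|²`. [folklore] -/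
theorem kineticDensity_prodFun {g : Fin N → Space → ℂ} (hg : ∀ i, Differentiable ℝ (g i))
    (X : Config N) :
    kineticDensity (prodFun g) X = ∑ i, (∏ j ∈ Finset.univ.erase i, ((‖g j (X j)‖₊ : ℝ≥0∞) ^ 2)) *
      ∑ k : Fin 3, ((‖fderiv ℝ (g i) (X i) (EuclideanSpace.single k 1)‖₊ : ℝ≥0∞) ^ 2) := by
  unfold kineticDensity
  refine Finset.sum_congr rfl fun i _ => ?_
  rw [Finset.mul_sum]
  refine Finset.sum_congr rfl fun k _ => ?_
  rw [fderiv_prodFun hg, nnnorm_mul, ENNReal.coe_mul, mul_pow, nnnorm_prod,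
    ENNReal.ofNNReal_finsetProd, ← Finset.prod_pow]

/-- Kinetic density of `φ^{⊗N}`. [folklore] -/
theorem kineticDensity_symFun (hL : 0 < L) (X : Config (m + 1)) :
    kineticDensity (symFun m L n a b) X = ∑ i : Fin (m + 1),
      ENNReal.ofReal (b ^ 2 * (4 * Real.pi ^ 2 * nsq n / L ^ 2)) *
        ∏ j ∈ Finset.univ.erase i, ((‖oneBody L n a b (X j)‖₊ : ℝ≥0∞) ^ 2) := by
  unfold symFun
  rw [kineticDensity_prodFun (fun _ => differentiable_oneBody L n a b)]
  refine Finset.sum_congr rfl fun i _ => ?_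
  rw [sum_nnnorm_sq_fderiv_oneBody hL, mul_comm]

/-- `∫⁻_{cell^N} Π_{j≠i} F(x_j) = L³ Π_{j≠i} ∫⁻_cell F`. [folklore] -/
theorem lintegral_prod_erase (i : Fin N) {F : Space → ℝ≥0∞} (hF : Measurable F) :
    ∫⁻ X in cellN N L, ∏ j ∈ Finset.univ.erase i, F (X j) =
      ENNReal.ofReal L ^ 3 * ∏ _j ∈ Finset.univ.erase i, ∫⁻ x in cell L, F x := by
  classical
  have h : ∀ X : Config N, ∏ j ∈ Finset.univ.erase i, F (X j) =
      ∏ j, (if j = i then (1 : ℝ≥0∞) else F (X j)) := by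
    intro X
    rw [← Finset.mul_prod_erase Finset.univ _ (Finset.mem_univ i), if_pos rfl, one_mul]
    exact Finset.prod_congr rfl fun j hj => by rw [if_neg (Finset.ne_of_mem_erase hj)]
  simp_rw [h]
  rw [lintegral_cellN_prod (fun j x => if j = i then (1 : ℝ≥0∞) else F x)
    (fun j => by split_ifs; exacts [measurable_const, hF])]
  rw [← Finset.mul_prod_erase Finset.univ _ (Finset.mem_univ i)]
  simp only [if_true, lintegral_cell_const, one_mul]
  congr 1
  exact Finset.prod_congr rfl fun j hj => by simp only [if_neg (Finset.ne_of_mem_erase hj)]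

/-- `‖a + b e_n‖₊²` is measurable. [folklore] -/
theorem measurable_nnnorm_sq_oneBody (L : ℝ) (n : Fin 3 → ℤ) (a b : ℝ) :
    Measurable fun x => ((‖oneBody L n a b x‖₊ : ℝ≥0∞) ^ 2) :=
  (continuous_oneBody L n a b).measurable.nnnorm.coe_nnreal_ennreal.pow_const _

/-- **Kinetic energy of `φ^{⊗N}`**: `N · (b²L³) · k²`, `k² = 4π²|n|²/L²`. -/
theorem periodicEnergy_symState (hL : 0 < L) (hn : n ≠ 0) (hab : (a ^ 2 + b ^ 2) * L ^ 3 = 1) :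
    periodicEnergy 0 (symState m hL hn a b hab) =
      ENNReal.ofReal (((m + 1 : ℕ) : ℝ) * ((b ^ 2 * L ^ 3) * (4 * Real.pi ^ 2 * nsq n / L ^ 2))) := by
  unfold periodicEnergy
  simp only [periodicInteraction_zero, zero_mul, add_zero]
  show ∫⁻ X in cellN (m + 1) L, kineticDensity (symFun m L n a b) X = _
  simp_rw [kineticDensity_symFun hL]
  have hF := measurable_nnnorm_sq_oneBody L n a b
  have hI : ∫⁻ x in cell L, ((‖oneBody L n a b x‖₊ : ℝ≥0∞) ^ 2) = 1 := by
    rw [lintegral_nnnorm_sq_oneBody hL hn, hab, ENNReal.ofReal_one]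
  have hmeas : ∀ i : Fin (m + 1), Measurable (fun X : Config (m + 1) =>
      ENNReal.ofReal (b ^ 2 * (4 * Real.pi ^ 2 * nsq n / L ^ 2)) *
        ∏ j ∈ Finset.univ.erase i, ((‖oneBody L n a b (X j)‖₊ : ℝ≥0∞) ^ 2)) := fun i =>
    measurable_const.mul (Finset.measurable_prod _ fun j _ => hF.comp (measurable_pi_apply j))
  rw [lintegral_finsetSum _ (fun i _ => hmeas i)]
  have hterm : ∀ i : Fin (m + 1), ∫⁻ X in cellN (m + 1) L,
      ENNReal.ofReal (b ^ 2 * (4 * Real.pi ^ 2 * nsq n / L ^ 2)) *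
        ∏ j ∈ Finset.univ.erase i, ((‖oneBody L n a b (X j)‖₊ : ℝ≥0∞) ^ 2) =
      ENNReal.ofReal ((b ^ 2 * L ^ 3) * (4 * Real.pi ^ 2 * nsq n / L ^ 2)) := by
    intro i
    rw [lintegral_const_mul' _ _ ENNReal.ofReal_ne_top, lintegral_prod_erase i hF]
    simp only [hI, Finset.prod_const_one, mul_one]
    have hK : 0 ≤ b ^ 2 * (4 * Real.pi ^ 2 * nsq n / L ^ 2) :=
      mul_nonneg (sq_nonneg _) (div_nonneg (mul_nonneg (by positivity) (nsq_nonneg n)) (sq_nonneg _))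
    rw [← ENNReal.ofReal_pow hL.le, ← ENNReal.ofReal_mul hK]
    congr 1
    ring
  simp only [hterm]
  rw [Finset.sum_const, Finset.card_univ, Fintype.card_fin, nsmul_eq_mul,
    ← ENNReal.ofReal_natCast (m + 1), ← ENNReal.ofReal_mul (Nat.cast_nonneg _)]

end SymState

end Summit.AtomisticToContinuum.BoseEinsteinCondensation.Theorems.GaussianDominationCan.Negative

end
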